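import Literature.NumberTheory.Automorphic.QuadraticBaseChangeFrobCompatibleOfLFactorProofs
import Literature.NumberTheory.Automorphic.GL2SphericalOfLFactorDegreeTwo
import HarnessLib

/-!
# The unramifiedness clause of Carayol's compatibility from local–global compatibility

Topic `Literature/NumberTheory/Automorphic`; proof companion (theorems only) of the named fact
`Carayol1986_unramifiedCompatibility` (`HilbertModularGaloisRepUnramified`).  That fact has two
clauses at a finite place `w ∤ ℓ` of a totally real `K`, for `π` regular algebraic cuspidal on
`GL₂(𝔸_K)` and `r : Γ_K → GL₂(ℚ̄_ℓ)` irreducible and a.e. compatible with `π`: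
(i) compatibility AT `w` (`IsGaloisCompatibleAt π ι r w`), and (ii) `r` unramified at `w` ⇒ `π`
unramified at `w`.  Here clause (ii) is DERIVED from the tree's local–global compatibility fact
`galoisRep_GL2_totallyReal_localGlobal` (`HilbertModularLocalGlobal`: "`rec_w(π_w) =
WD(r|_w)^{F-ss}` at every `w ∤ ℓ`", Carayol 1986 / Taylor 1989) and the now PROVED local theorem

> (JL) an irreducible smooth representation `πᵥ` of `GL₂(F)` whose JPSS `L`-factor `L(s, πᵥ × 1)`
> has degree `2` (for all invariant measures) is spherical

(`exists_mem_fixedPoints_glInt_of_hasRSLFactor_natDegree_two`, `GL2SphericalOfLFactorDegreeTwo`;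
it is also, verbatim, the `_holds` of the named fact
`JacquetLanglands1970_spherical_of_natDegree_lFactor_eq_two` of `GL2LFactorDegreeTwoSpherical`),
exactly as in `isUnramifiedAt_of_isGaloisCompatibleAt_of_localGlobal_of_lFactor`
(`QuadraticBaseChangeFrobCompatibleOfLFactorProofs`), whose every-place hypothesis `hcomp` was only
used almost everywhere.  Clause (i) additionally needs the unramified normalisation of the abstract
local Langlands datum (`rec` of a spherical `π(χ₁, χ₂)` is `χ₁ ⊕ χ₂` through `Art`), which is not a
clause of `LocalLanglandsDatum`, and is not derived here.

Consequence for `Langlands1980_quadraticBaseChange_frobCompatible` (`QuadraticBaseChangeFrobCompatible`):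
with (JL) proved, route (β′) is free of un-named input —
`Langlands1980_quadraticBaseChange_frobCompatible_holds` is the term
`Langlands1980_quadraticBaseChange_frobCompatible_of_localGlobal_of_lFactor
JacquetLanglands1970_spherical_of_natDegree_lFactor_eq_two_holds ‹galoisRep_GL2_totallyReal_localGlobal›
‹exists_galoisRep_of_regularAlgebraic› ‹ArthurClozel1989_strongLifting_archimedean›
‹baseChange_cyclic_cuspidal› ‹ArthurClozel1989_strongLifting_unramified›` in the `_holds` of those
five EXISTING named facts (none discharged yet; the gate's dedup treats the `hJL`-free restatement as
a duplicate of `…_of_localGlobal_of_lFactor`, so it is not re-stated as a theorem).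

## References

* H. Carayol, Ann. Sci. ÉNS 19 (1986), Thm. (A). [CarayolASENS1986]
* R. Taylor, Invent. Math. 98 (1989), Thms. 1–2. [TaylorInventMath1989]
* H. Jacquet, R. P. Langlands, LNM 114 (1970), Props. 3.5–3.6, Thm. 2.18. [JacquetLanglands1970]
* R. P. Langlands, *Base change for GL(2)* (1980), §2 (A), (F). [LanglandsBaseChange1980]
-/

noncomputable section

open scoped MatrixGroups Matrix NumberField TensorProduct
open NumberField IsDedekindDomain Field Filter Polynomial MeasureTheory

namespace Literature.NumberTheory.Automorphic

open Literature.NumberTheory.GaloisRepresentations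

/-- **The unramifiedness clause of Carayol's compatibility from local–global compatibility.**  `K`
totally real, `π` regular algebraic cuspidal on `GL₂(𝔸_K)`, `ℓ` prime, `ι : ℚ̄_ℓ ≃ ℂ`,
`r : Γ_K → GL₂(ℚ̄_ℓ)` irreducible and compatible with `π` (`C`-normalisation) at ALMOST EVERY finite
place; then at every finite `w ∤ ℓ` where `r` is unramified, `π` is unramified — the second
conjunct of the named fact `Carayol1986_unramifiedCompatibility`, derived from
`galoisRep_GL2_totallyReal_localGlobal` and (JL) exactly as
`isUnramifiedAt_of_isGaloisCompatibleAt_of_localGlobal_of_lFactor` (the a.e. hypothesis is all that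
proof uses). [cite: CarayolASENS1986, Thm. (A) (pp. 410–411)] [cite: Skinner2009, (1) p. 242] -/
theorem Carayol1986_unramifiedCompatibility.unramified_of_localGlobal
    (hLG : galoisRep_GL2_totallyReal_localGlobal)
    {K : Type} [Field K] [NumberField K] (hcpt : isCompact_glFiniteIntegralLevel 2 K)
    (hK : IsTotallyReal K) (π : CuspidalAutomorphicRepData 2 K hcpt) (hreg : π.1.IsRegularAlgebraic)
    (ℓ : ℕ) [Fact ℓ.Prime] (ι : PadicAlgCl ℓ ≃+* ℂ) (r : FramedGaloisRep K (PadicAlgCl ℓ) 2)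
    (hirr : r.toGaloisRep.IsIrreducible)
    (hae₀ : ∀ᶠ v : HeightOneSpectrum (𝓞 K) in cofinite,
      ∃ α : Multiset ℂ, π.1.HasSatakeParamAt v α ∧ r.IsUnramifiedAt v ∧
        r.HasFrobCharpolyAt v (arithFrobPolyOfSatake ι v.residueCard 2 α))
    (w : HeightOneSpectrum (𝓞 K)) (hw : ((ℓ : ℕ) : 𝓞 K) ∉ w.asIdeal) (hur : r.IsUnramifiedAt w) :
    π.1.IsUnramifiedAt w := by
  obtain ⟨T, hT, hC, hTreg⟩ := hreg
  -- the inverse half twist `π₁ = π ⊗ |det|^{-1/2}`: `L`-algebraic with a regular infinity type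
  obtain ⟨χ, π₁, hχ, hW, hW', hT₁⟩ := π.exists_twist_hasInfinityType (-(((2 : ℝ) - 1) / 2)) hT
  have e : (((-(((2 : ℝ) - 1) / 2) : ℝ)) : ℂ) = -((((2 : ℕ) : ℂ) - 1) / 2) := by push_cast; ring
  have hL₁ : π₁.1.IsLAlgebraic :=
    ⟨_, hT₁, InfinityType.isLAlgebraic_twist_of_isCAlgebraic hC e⟩
  have hreg₁ : ∃ T' : InfinityType K 2, π₁.1.HasInfinityType T' ∧ T'.IsRegular :=
    ⟨_, hT₁, hTreg.twist _⟩
  -- a.e. `C`-compatibility with `π` is a.e. `L`-compatibility with `π₁`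
  have hae : SatakeFrobCompatibleAE ι π₁.1 r := by
    filter_upwards [hae₀] with v ⟨β, hβ, hurv, hch⟩
    refine ⟨_, AutomorphicRepData.HasSatakeParamAt.of_map_mulChar_detTwist_of_cpow hχ hW hW' hβ,
      hurv, ?_⟩
    rwa [arithFrobPolyOfSatake_one_map_cpow_half_two ι v.residueCard]
  -- local–global compatibility for `π₁` at `w`: `rec_w(π₁,w)` is the class of an unramified `r'`
  obtain ⟨llc, hllc⟩ := galoisRep_GL2_totallyReal_localGlobal.exists_llc_recGL_unramified hLG K hK
  obtain ⟨πv, r', hr', hloc, hN, hur', hq⟩ := hllc hcpt π₁ hL₁ hreg₁ ℓ ι r hirr hae w hw hur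
  -- `π₁,w` is generic (a local component of a cuspidal Borel–Jacquet datum on `GL₂`)
  obtain ⟨ψ, hψ, hgen⟩ := π₁.exists_isGeneric_of_hasLocalComponentAt w πv.ρ πv.isSmooth hloc
  -- (JL): `L(s, π₁,w × 1)` has degree `2`, so `π₁,w` is spherical
  haveI : CharZero (w.adicCompletion K) :=
    charZero_of_injective_algebraMap (algebraMap K (w.adicCompletion K)).injective
  obtain ⟨x, hx0, hxK⟩ := exists_mem_fixedPoints_glInt_of_hasRSLFactor_natDegree_two πv ψ hψ
    (fun ν _ _ _ => hasRSLFactor_of_recGL_unramified (llc w) πv r' hr' hq hN hur' ψ hψ hgen ν)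
  rw [glInt_adicCompletion_eq] at hxK
  -- Borel–Jacquet dictionary; untwist
  have hπ₁ : π₁.1.IsUnramifiedAt w :=
    π₁.1.isUnramifiedAt_of_hasLocalComponentAt_of_mem_fixedPoints w πv hloc hx0 hxK
  exact (isUnramifiedAt_iff_of_twist hχ hW hW' w).mp hπ₁

end Literature.NumberTheory.Automorphic

end
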